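import Literature.NumberTheory.Rogawski1990.SingularObsHasse
import Literature.NumberTheory.Rogawski1990.SingularArchBlockSignatures
import HarnessLib

/-!
# Towards the singular ObsHasse: the ARCHIMEDEAN clause of the placewise socket `hreal` at `obs := singularObs`
# (Rogawski 1990, §3.3 Prop. 3.3.1 p. 22, §3.8 Prop. 3.8.1 (d) p. 30; Kottwitz 1986 §7, §9)

Topic `NumberTheory/Rogawski1990`; namespace `Literature.NumberTheory.Rogawski1990`; **THEOREMS ONLY** (no definition, no named fact, no instance, no
notation, no `sorry`).  Cell `pub/hodgecm-mathlib`, ENGINE T1 (crux H413 = `stmt-HodgeConjecture-24833`), row O7 «singular semisimple classes»: piece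
**(h5-arch)** = CLAUSE 7 of ★ P5″ `MatchingAdeleG₂.obsHasse_of_placewise`'s `hreal` at `obs := singularObs` (F0P5a-p03 TRUNK WORDS #7–#10, O7 OWNER WORD #15∕#16),
the `∞`-twin of ★ (h5-fin) `MatchingAdeleG₂.exists_localCartan_eq_of_adelicBlockDet_eq` (`SingularObsHasse` §2).  HC_CM is proved only modulo the
printed citations until rung 0 closes.

THE MATHEMATICS.  `H` hermitian non-degenerate over the CM field `L`, `γ₀ ∈ U(H)(L⁺)` singular non-central semisimple with PLANE-FIRST frame `P`
(`ᵗ(σP) H P = H_a ⊕ᶠ H_b`, `γ₀ P = P (a·1₂ ⊕ᶠ b·1₁)`, `a ≠ b`), a global framed `y ∈ Z(γ₀)` (`y⋆ = y`, `det y = 1`, `ᵗ(σP)(Hy)P = Y_a ⊕ᶠ Y_b`,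
`det Y_a = k det H_a`) whose total signatures at the complex embeddings are those of `H` (clause 5 of `hreal`, ★ (R6a-s′)), and an adelic conjugator `g`
of a matching adèle with `adelicBlockDet γ₀ a b g = (k ⊗ 1) · σ_𝔸(z) z`.  At `∞` (`π_∞ : 𝔸_L → L ⊗ ℝ`, `σ_∞ = c ⊗ 1`) the transported form `(H_g)_∞` is
block diagonal in the frame with plane block `H_a y₁` (★ `exists_twistGram_frame_eq_finSum`), and the idempotent∕frame bridge ★ `blockDet_lagrangeIdem_eq_det`
reads `det y₁ = π_∞(adelicBlockDet) = (k ⊗ 1)_∞ · σ_∞(z_∞) z_∞`; hence at every complex place `w` the plane-block determinants of `(Hy)_∞` and `(H_g)_∞`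
are `(k det H_a)_w` and `(k det H_a)_w · |z_w|²` — SAME SIGN — while the totals `(Hy)_w`, `(H_g)_w = g_wᴴ H_w g_w` both have the signature of `H_w`.
These are exactly the hypotheses of ★ `exists_commute_twistGram_arch_eq_of_signatures_of_det_sign_cm` ((h3′) in sign form, Sylvester at `∞`),
which returns `t ∈ GL₃(L ⊗ ℝ)` commuting with `(γ₀)_∞` and `ᵗ(σ_∞ t) (Hy)_∞ t = (H_g)_∞`, i.e. `(x_g)_∞ = t⋆ (y ⊗ 1)_∞ t` — clause 7.
No positivity of `k` and no `det Y_b` bookkeeping enter at `∞` (the sign is DATA, read — not assumed).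

* §1 **`MatchingAdeleG₂.exists_archCartan_eq_of_adelicBlockDet_eq`** — binders = ★ (h5-fin)'s minus `(v w hw) (hYb) (hk0)`, plus `hsigy` (clause 5 verbatim);
  conclusion = clause 7 verbatim.  Lean note: the archimedean letters `π_∞`, `F := π_∞ ∘ (· ⊗ 1)` are made opaque (`clear_value`) so that definitional
  unfolding never reaches the completions behind `InfiniteAdeleRing.ringEquiv_mixedSpace` (default heartbeats).

## References
* [Rogawski1990] J. D. Rogawski, *Automorphic Representations of Unitary Groups in Three Variables*, Ann. of Math. Stud. 123 (1990), §3.3 Prop. 3.3.1 p. 22,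
  §3.8 Prop. 3.8.1 (d) p. 30.
* [Kottwitz1986] R. E. Kottwitz, *Stable trace formula: elliptic singular terms*, Math. Ann. 275 (1986), §7 Prop. 7.1, §9.
* [BorelJacquet1979] A. Borel, H. Jacquet, PSPM 33.1 (1979), §4.1 (`G(𝔸) → G(E ⊗ ℝ)`).
-/

set_option autoImplicit false

noncomputable section

open NumberField IsDedekindDomain
open scoped Matrix MatrixGroups ComplexConjugate ComplexOrder

namespace Literature.NumberTheory.Rogawski1990

open Literature.NumberTheory.Automorphic Literature.NumberTheory.Automorphic.UnitaryGroup
open Literature.AlgebraicGeometry.ShimuraVarieties (unitaryGroup)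

section Arch

variable {L : Type} [Field L] [NumberField L] [IsCMField L] {H : Matrix (Fin 3) (Fin 3) L} {γ₀ : (UnitaryGroup.cmDatum L 3 H).Rational}

/-- `(A ⊕ᶠ B)(C ⊕ᶠ D) = AC ⊕ᶠ BD`. [folklore] -/
private theorem finSum_mul_finSum₁ {S : Type*} [CommRing S] {N₁ N₂ : ℕ} (A C : Matrix (Fin N₁) (Fin N₁) S) (B D : Matrix (Fin N₂) (Fin N₂) S) :
    finSum N₁ N₂ A B * finSum N₁ N₂ C D = finSum N₁ N₂ (A * C) (B * D) := by
  simp only [finSum, Matrix.reindex_apply, Matrix.submatrix_mul_equiv, Matrix.fromBlocks_multiply, Matrix.mul_zero, Matrix.zero_mul,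
    add_zero, zero_add]

/-- Positive-index counts of equal hermitian matrices agree (transport along `X = A`). [folklore] -/
private theorem card_pos_eigenvalues_congr {n : Type} [Fintype n] [DecidableEq n] {X A : Matrix n n ℂ} (h : X = A) (hX : X.IsHermitian)
    (hA : A.IsHermitian) :
    (Finset.univ.filter fun i => 0 < hX.eigenvalues i).card = (Finset.univ.filter fun i => 0 < hA.eigenvalues i).card := by
  subst h
  rfl

/-- `π_∞` intertwines `σ_𝔸` with `σ_∞ = c ⊗ 1` on `L ⊗ ℝ` (★ `ringEquiv_mixedSpace_fst_adeleConj`). [cite: BorelJacquet1979, §4.1] -/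
private theorem arch_adeleConj (x : AdeleRing (𝓞 L) L) :
    ((InfiniteAdeleRing.ringEquiv_mixedSpace L).toRingHom.comp (UnitaryGroup.adeleFst L)) (adeleConj L x) =
      UnitaryGroup.conjMixed (↥(maximalRealSubfield L)) L (IsCMField.complexConj L)
        (((InfiniteAdeleRing.ringEquiv_mixedSpace L).toRingHom.comp (UnitaryGroup.adeleFst L)) x) := by
  simp only [RingHom.coe_comp, RingEquiv.toRingHom_eq_coe, RingHom.coe_coe, Function.comp_apply]
  exact QuadraticForms.ringEquiv_mixedSpace_fst_adeleConj L x

/-- **(h5-arch) THE ARCHIMEDEAN CLAUSE OF `hreal` AT `obs := singularObs`** — the `∞`-twin of ★ (h5-fin)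
`MatchingAdeleG₂.exists_localCartan_eq_of_adelicBlockDet_eq`, in the letters of clause 7 of ★ P5″ `MatchingAdeleG₂.obsHasse_of_placewise`'s `hreal`.
Data: `H` hermitian non-degenerate over the CM field `L`; a singular non-central semisimple `γ₀ ∈ U(H)(L⁺)` with its PLANE-FIRST frame `P`
(`ᵗ(σP) H P = H_a ⊕ᶠ H_b`, `γ₀ P = P (a·1₂ ⊕ᶠ b·1₁)`, `a ≠ b`); a global `y ∈ Z(γ₀)`, `⋆`-symmetric with `det y = 1`, framed as `ᵗ(σP) (H y) P = Y_a ⊕ᶠ Y_b` with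
`det Y_a = k · det H_a`, whose total signatures are those of `H` (`hsigy` = clause 5 of `hreal`, ★ (R6a-s′)); a matching adèle `p` with adelic conjugator `g`
whose block-determinant class is `adelicBlockDet γ₀ a b g = (k ⊗ 1) · σ_𝔸(z) z` (★ `singularObs_eq_zero_iff` + ★ `IsPrincipalAdelicNorm`).  Then there is
`t ∈ GL₃(L ⊗ ℝ)` commuting with `(γ₀)_∞` with `(x_g)_∞ = t⋆ (y ⊗ 1)_∞ t`.  Route: frame everything at `∞` (`π_∞`, `σ_∞ = c ⊗ 1`); `(H_g)_∞` is block diagonal in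
the frame (★ `exists_twistGram_frame_eq_finSum`) with plane block `H_a y₁`, and the ★ bridge `blockDet_lagrangeIdem_eq_det` gives `det y₁ = π_∞(adelicBlockDet)
= (k ⊗ 1)_∞ · σ_∞(z_∞) z_∞`; so at every complex place `w` the plane-block determinants `det(Y_a)_w = (k det H_a)_w` and `det(H_a y₁)_w = (k det H_a)_w · |z_w|²`
have the SAME SIGN, and the total signatures of `(H y)_w`, `(H_g)_w` are both those of `H_w` (`hsigy` ∕ Sylvester ★ `Landherr.card_pos_eigenvalues_eq_of_congr`)
— exactly the hypotheses of ★ `exists_commute_twistGram_arch_eq_of_signatures_of_det_sign_cm` ((h3′) in sign form).  No positivity of `k` and no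
`det Y_b` bookkeeping are needed at `∞`. [cite: Rogawski1990, §3.8 Prop. 3.8.1 (d) p. 30; §3.3 (3.3.1) p. 22] [cite: Kottwitz1986, §7, §9] [cite: BorelJacquet1979, §4.1] -/
theorem MatchingAdeleG₂.exists_archCartan_eq_of_adelicBlockDet_eq (hH : (H.map (cmConjRingHom L))ᵀ = H) (hHd : H.det ≠ 0) {a b : L} (hab : a ≠ b)
    {P : GL (Fin 3) L} {Ha : Matrix (Fin 2) (Fin 2) L} {Hb : Matrix (Fin 1) (Fin 1) L}
    (hP : (((P : Matrix (Fin 3) (Fin 3) L)).map (cmConjRingHom L))ᵀ * H * (P : Matrix (Fin 3) (Fin 3) L) = finSum 2 1 Ha Hb)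
    (hγP : (((γ₀ : unitaryGroup (cmConjRingHom L) H).val : GL (Fin 3) L) : Matrix (Fin 3) (Fin 3) L) * (P : Matrix (Fin 3) (Fin 3) L) =
      (P : Matrix (Fin 3) (Fin 3) L) * finSum 2 1 (a • (1 : Matrix (Fin 2) (Fin 2) L)) (b • (1 : Matrix (Fin 1) (Fin 1) L)))
    {y : Matrix (Fin 3) (Fin 3) L} {Ya : Matrix (Fin 2) (Fin 2) L} {Yb : Matrix (Fin 1) (Fin 1) L} {k : L}
    (hys : hermStar (cmConjRingHom L) H y = y) (hy1 : y.det = 1)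
    (hyP : (((P : Matrix (Fin 3) (Fin 3) L)).map (cmConjRingHom L))ᵀ * (H * y) * (P : Matrix (Fin 3) (Fin 3) L) = finSum 2 1 Ya Yb)
    (hYa : Ya.det = k * Ha.det)
    (hsigy : ∀ (ρ : L →+* ℂ) (h₁ : (H.map ρ).IsHermitian) (h₂ : ((H * y).map ρ).IsHermitian),
      (Finset.univ.filter fun i => 0 < h₁.eigenvalues i).card = (Finset.univ.filter fun i => 0 < h₂.eigenvalues i).card)
    (p : MatchingAdeleG₂ L H H γ₀) (g : GL (Fin 3) (AdeleRing (𝓞 L) L))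
    (hg : g * (((UnitaryGroup.cmDatum L 3 H).toAdelic γ₀).val : GL (Fin 3) (AdeleRing (𝓞 L) L)) * g⁻¹ = (p.adele.val : GL (Fin 3) (AdeleRing (𝓞 L) L)))
    {z : (AdeleRing (𝓞 L) L)ˣ}
    (hδ : adelicBlockDet γ₀ a b g = algebraMap L (AdeleRing (𝓞 L) L) k * (adeleConj L (z : AdeleRing (𝓞 L) L) * (z : AdeleRing (𝓞 L) L))) :
    ∃ t : GL (Fin 3) (NumberField.mixedEmbedding.mixedSpace L),
      t * Matrix.GeneralLinearGroup.map ((InfiniteAdeleRing.ringEquiv_mixedSpace L).toRingHom.comp (UnitaryGroup.adeleFst L))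
            (((UnitaryGroup.cmDatum L 3 H).toAdelic γ₀).val : GL (Fin 3) (AdeleRing (𝓞 L) L)) =
        Matrix.GeneralLinearGroup.map ((InfiniteAdeleRing.ringEquiv_mixedSpace L).toRingHom.comp (UnitaryGroup.adeleFst L))
            (((UnitaryGroup.cmDatum L 3 H).toAdelic γ₀).val : GL (Fin 3) (AdeleRing (𝓞 L) L)) * t ∧
      ((H.map (algebraMap L (AdeleRing (𝓞 L) L)))⁻¹ * twistGram (adeleConj L) (H.map (algebraMap L (AdeleRing (𝓞 L) L))) (g : Matrix (Fin 3) (Fin 3) (AdeleRing (𝓞 L) L))).map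
          ((InfiniteAdeleRing.ringEquiv_mixedSpace L).toRingHom.comp (UnitaryGroup.adeleFst L)) =
        hermStar (UnitaryGroup.conjMixed (↥(maximalRealSubfield L)) L (IsCMField.complexConj L))
            ((H.map (algebraMap L (AdeleRing (𝓞 L) L))).map ((InfiniteAdeleRing.ringEquiv_mixedSpace L).toRingHom.comp (UnitaryGroup.adeleFst L)))
            (t.val : Matrix (Fin 3) (Fin 3) (NumberField.mixedEmbedding.mixedSpace L)) *
          (y.map (algebraMap L (AdeleRing (𝓞 L) L))).map ((InfiniteAdeleRing.ringEquiv_mixedSpace L).toRingHom.comp (UnitaryGroup.adeleFst L)) *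
          (t.val : Matrix (Fin 3) (Fin 3) (NumberField.mixedEmbedding.mixedSpace L)) := by
  -- LETTERS at `∞`
  set 𝔸 := AdeleRing (𝓞 L) L with h𝔸
  set πv : 𝔸 →+* NumberField.mixedEmbedding.mixedSpace L := (InfiniteAdeleRing.ringEquiv_mixedSpace L).toRingHom.comp (UnitaryGroup.adeleFst L)
    with hπv
  set σv := UnitaryGroup.conjMixed (↥(maximalRealSubfield L)) L (IsCMField.complexConj L) with hσv
  set F : L →+* NumberField.mixedEmbedding.mixedSpace L := πv.comp (algebraMap L 𝔸) with hFdef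
  have hπσ : ∀ x : 𝔸, πv (adeleConj L x) = σv (πv x) := fun x => arch_adeleConj x
  have hF : ∀ r : L, F (cmConjRingHom L r) = σv (F r) := fun r => by
    show πv (algebraMap L 𝔸 (cmConjRingHom L r)) = σv (πv (algebraMap L 𝔸 r))
    rw [← adeleConj_algebraMap, hπσ]
  have hc1 : IsCMField.complexConj L ≠ 1 := IsCMField.complexConj_ne_one L
  have hfix : ∀ w : InfinitePlace L, IsCMField.complexConj L • w = w := UnitaryGroup.complexConj_smul_infinitePlace L
  have hσσv : ∀ x, σv (σv x) = x := conjMixed_conjMixed_apply _ L _ hc1 hfix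
  -- make the archimedean letters OPAQUE (their unfolding — completions, `ringEquiv_mixedSpace` — is what `isDefEq` must never see)
  clear_value F πv
  -- names for the mapped objects
  set Hv : Matrix (Fin 3) (Fin 3) (NumberField.mixedEmbedding.mixedSpace L) := (H.map (algebraMap L 𝔸)).map πv with hHv
  have hHvF : Hv = H.map F := by rw [hHv, hFdef, RingHom.coe_comp, ← Matrix.map_map]
  set Pv : GL (Fin 3) (NumberField.mixedEmbedding.mixedSpace L) := Matrix.GeneralLinearGroup.map F P with hPvdef
  have hPv : Pv.val = (P : Matrix (Fin 3) (Fin 3) L).map F := rfl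
  set γ𝔸 : GL (Fin 3) 𝔸 := ((UnitaryGroup.cmDatum L 3 H).toAdelic γ₀).val with hγ𝔸
  have hγ𝔸val : (γ𝔸 : Matrix (Fin 3) (Fin 3) 𝔸) = ((((γ₀ : unitaryGroup (cmConjRingHom L) H).val : GL (Fin 3) L) : Matrix (Fin 3) (Fin 3) L)).map
      (algebraMap L 𝔸) := by
    rw [hγ𝔸, UnitaryGroup.coe_cmDatum_toAdelic, val_toAdeleGL]
  set γv : Matrix (Fin 3) (Fin 3) (NumberField.mixedEmbedding.mixedSpace L) := (γ𝔸 : Matrix (Fin 3) (Fin 3) 𝔸).map πv with hγvdef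
  have hγvF : γv = ((((γ₀ : unitaryGroup (cmConjRingHom L) H).val : GL (Fin 3) L) : Matrix (Fin 3) (Fin 3) L)).map F := by
    rw [hγvdef, hγ𝔸val, hFdef, RingHom.coe_comp, ← Matrix.map_map]
  set xg : Matrix (Fin 3) (Fin 3) 𝔸 := (H.map (algebraMap L 𝔸))⁻¹ * twistGram (adeleConj L) (H.map (algebraMap L 𝔸)) (g : Matrix (Fin 3) (Fin 3) 𝔸) with hxg
  set xv : Matrix (Fin 3) (Fin 3) (NumberField.mixedEmbedding.mixedSpace L) := xg.map πv with hxvdef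
  -- unit determinants
  have hHu : IsUnit H.det := isUnit_iff_ne_zero.mpr hHd
  have hHvd : IsUnit Hv.det := by rw [hHvF, ← RingHom.mapMatrix_apply, ← RingHom.map_det]; exact hHu.map F
  have hFab : IsUnit (F a - F b) := by rw [← map_sub]; exact (IsUnit.mk0 _ (sub_ne_zero.mpr hab)).map F
  -- (1) the frame at `∞`
  have hPv_frame : twistGram σv Hv Pv.val = finSum 2 1 (Ha.map F) (Hb.map F) := by
    rw [hHvF, hPv, ← twistGram_map (cmConjRingHom L) H σv F hF, twistGram_def, hP, finSum_map]
  have hsmul1 : ∀ (n : ℕ) (c : L), (c • (1 : Matrix (Fin n) (Fin n) L)).map F = F c • (1 : Matrix (Fin n) (Fin n) (NumberField.mixedEmbedding.mixedSpace L)) :=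
    fun n c => by rw [Matrix.map_smul' _ _ _ (map_mul F), Matrix.map_one _ (map_zero F) (map_one F)]
  have hγv_frame : γv * Pv.val =
      Pv.val *
        finSum 2 1 (F a • (1 : Matrix (Fin 2) (Fin 2) (NumberField.mixedEmbedding.mixedSpace L)))
          (F b • (1 : Matrix (Fin 1) (Fin 1) (NumberField.mixedEmbedding.mixedSpace L))) := by
    rw [hγvF, hPv, ← Matrix.map_mul, hγP, Matrix.map_mul, finSum_map, hsmul1, hsmul1]
  -- (2) the two hermitian forms at `∞`: `G = (H y)_∞`, `G' = (H_g)_∞`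
  set G : Matrix (Fin 3) (Fin 3) (NumberField.mixedEmbedding.mixedSpace L) := (H * y).map F with hGdef
  set G' : Matrix (Fin 3) (Fin 3) (NumberField.mixedEmbedding.mixedSpace L) := twistGram σv Hv ((g : Matrix (Fin 3) (Fin 3) 𝔸).map πv) with hG'def
  have hHy : ((H * y).map (cmConjRingHom L))ᵀ = H * y := by
    have h := congrArg (fun M => H * M) hys
    simp only [hermStar_def, ← Matrix.mul_assoc, Matrix.mul_nonsing_inv _ hHu, Matrix.one_mul] at h
    rw [Matrix.map_mul, Matrix.transpose_mul, hH, h]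
  have hσF : (⇑σv ∘ ⇑F : L → NumberField.mixedEmbedding.mixedSpace L) = ⇑F ∘ ⇑(cmConjRingHom L) := funext fun r => (hF r).symm
  have hG : (G.map σv)ᵀ = G := by
    rw [hGdef, Matrix.map_map, hσF, ← Matrix.map_map, ← Matrix.transpose_map, hHy]
  have hσvHv : (Hv.map σv)ᵀ = Hv := by
    rw [hHvF, Matrix.map_map, hσF, ← Matrix.map_map, ← Matrix.transpose_map, hH]
  have hG' : (G'.map σv)ᵀ = G' := conjTranspose_twistGram σv Hv hσσv hσvHv _
  have hGd : IsUnit G.det := by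
    rw [hGdef, ← RingHom.mapMatrix_apply, ← RingHom.map_det, Matrix.det_mul, hy1, mul_one]; exact hHu.map F
  have hgvd : IsUnit ((g : Matrix (Fin 3) (Fin 3) 𝔸).map πv).det := by
    rw [← RingHom.mapMatrix_apply, ← RingHom.map_det]; exact (Matrix.isUnits_det_units g).map πv
  have hG'd : IsUnit G'.det := by
    rw [hG'def, det_twistGram]; exact ((hgvd.map σv).mul hHvd).mul hgvd
  -- (3) the frames of `G` and `G'`
  have hGP : twistGram σv G Pv.val = finSum 2 1 (Ya.map F) (Yb.map F) := by
    rw [hGdef, hPv, ← twistGram_map (cmConjRingHom L) (H * y) σv F hF, twistGram_def, hyP, finSum_map]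
  have hxv_eq : xv = Hv⁻¹ * G' := by
    rw [hxvdef, hxg, hG'def, hHv, hπv]; exact map_arch_inv_mul_twistGram hHd _
  have hxv_comm : Hv⁻¹ * G' * γv = γv * (Hv⁻¹ * G') := by
    rw [← hxv_eq, hxvdef, hγvdef, ← Matrix.map_mul, ← Matrix.map_mul]
    exact congrArg (fun M : Matrix (Fin 3) (Fin 3) 𝔸 => M.map ⇑πv) (commute_adelicCartan hHu p hg).eq
  obtain ⟨y₁, y₂, hG'P⟩ := exists_twistGram_frame_eq_finSum (N₁ := 2) (N₂ := 1) σv hHvd hFab hPv_frame hγv_frame hxv_comm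
  change Matrix (Fin 2) (Fin 2) (NumberField.mixedEmbedding.mixedSpace L) at y₁
  change twistGram σv G' Pv.val = finSum 2 1 (Ha.map F * y₁) (Hb.map F * y₂) at hG'P
  -- (4) `x_∞` in the frame and the plane-block determinant
  have hPu : IsUnit Pv.val.det := by
    rw [hPv, ← RingHom.mapMatrix_apply, ← RingHom.map_det]; exact (Matrix.isUnits_det_units P).map F
  have hxvP : xv * Pv.val = Pv.val * finSum 2 1 y₁ y₂ := by
    have hfu : IsUnit (finSum 2 1 (Ha.map F) (Hb.map F)).det := by
      rw [← hPv_frame, det_twistGram]; exact ((hPu.map σv).mul hHvd).mul hPu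
    have h1 : finSum 2 1 (Ha.map F) (Hb.map F) * (Pv.val⁻¹ * xv * Pv.val) = finSum 2 1 (Ha.map F) (Hb.map F) * finSum 2 1 y₁ y₂ := by
      rw [finSum_mul_finSum₁, ← hG'P, ← hPv_frame, twistGram_def, twistGram_def, hxv_eq]
      simp only [Matrix.mul_assoc]
      rw [Matrix.mul_nonsing_inv_cancel_left _ _ hPu, Matrix.mul_nonsing_inv_cancel_left _ _ hHvd]
    have h2 : Pv.val⁻¹ * xv * Pv.val = finSum 2 1 y₁ y₂ := by
      have h := congrArg (fun M => (finSum 2 1 (Ha.map F) (Hb.map F))⁻¹ * M) h1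
      simpa only [← Matrix.mul_assoc, Matrix.nonsing_inv_mul _ hfu, Matrix.one_mul] using h
    rw [← h2, ← Matrix.mul_assoc, ← Matrix.mul_assoc, Matrix.mul_nonsing_inv _ hPu, Matrix.one_mul]
  have hev : (adelicLagrangeIdem γ₀ a b).map ⇑πv = F (a - b)⁻¹ • (γv - F b • (1 : Matrix (Fin 3) (Fin 3) (NumberField.mixedEmbedding.mixedSpace L))) := by
    rw [adelicLagrangeIdem_eq, Matrix.map_smul' _ _ _ (map_mul πv), Matrix.map_sub _ (map_sub πv), Matrix.map_smul' _ _ _ (map_mul πv),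
      Matrix.map_one _ (map_zero πv) (map_one πv), hγvdef, hγ𝔸, hFdef, RingHom.comp_apply, RingHom.comp_apply]
  have hu : F (a - b)⁻¹ * (F a - F b) = 1 := by
    rw [← map_sub, ← map_mul, inv_mul_cancel₀ (sub_ne_zero.2 hab), map_one]
  have hdet₁' : y₁.det = F k * (σv (πv (z : 𝔸)) * πv (z : 𝔸)) := by
    rw [← blockDet_lagrangeIdem_eq_det (N₁ := 2) (N₂ := 1) (P := Pv) hγv_frame hu hxvP, ← hev, hxvdef, hxg, blockDet_map, ← adelicBlockDet_def, hδ, map_mul, map_mul,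
      hπσ, hFdef, RingHom.comp_apply]
  -- (5) the hypotheses of ★ (h3′) in sign form: total signatures and the sign of the plane-block determinant, place by place
  have hsig : ∀ (w : {w : InfinitePlace L // w.IsComplex}) (h₁ : (G.map (UnitaryGroup.evalC L w)).IsHermitian)
      (h₂ : (G'.map (UnitaryGroup.evalC L w)).IsHermitian),
      (Finset.univ.filter fun i => 0 < h₁.eigenvalues i).card = (Finset.univ.filter fun i => 0 < h₂.eigenvalues i).card := by
    intro w h₁ h₂
    -- `G_w = (H y)` at the embedding of `w`, `Hv_w = H` at the embedding of `w`
    have hGw : G.map (UnitaryGroup.evalC L w) = (H * y).map w.1.embedding := by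
      rw [hGdef, hFdef, RingHom.coe_comp, ← Matrix.map_map, hπv, QuadraticForms.map_algebraMap_map_arch, UnitaryGroup.archFormOf_map_evalC]
    have hHw : Hv.map (UnitaryGroup.evalC L w) = H.map w.1.embedding := by
      rw [hHv, hπv, QuadraticForms.map_algebraMap_map_arch, UnitaryGroup.archFormOf_map_evalC]
    have hHwh : (H.map w.1.embedding).IsHermitian := by
      rw [← hHw]; exact isHermitian_map_evalC_of_transpose_map_conjMixed _ L _ hc1 hfix hσvHv w
    have hHyh : ((H * y).map w.1.embedding).IsHermitian := by
      rw [← hGw]; exact isHermitian_map_evalC_of_transpose_map_conjMixed _ L _ hc1 hfix hG w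
    -- `G'_w = g_wᴴ H_w g_w`
    have hG'w : (((g : Matrix (Fin 3) (Fin 3) 𝔸).map πv).map (UnitaryGroup.evalC L w))ᴴ * H.map w.1.embedding *
        ((g : Matrix (Fin 3) (Fin 3) 𝔸).map πv).map (UnitaryGroup.evalC L w) = G'.map (UnitaryGroup.evalC L w) := by
      rw [hG'def, twistGram_conjMixed_map_evalC _ L _ hc1 hfix, hHw]
    have hgw : IsUnit (((g : Matrix (Fin 3) (Fin 3) 𝔸).map πv).map (UnitaryGroup.evalC L w)).det := by
      rw [← RingHom.mapMatrix_apply, ← RingHom.map_det]; exact hgvd.map _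
    rw [card_pos_eigenvalues_congr hGw h₁ hHyh, ← hsigy w.1.embedding hHwh hHyh,
      QuadraticForms.Landherr.card_pos_eigenvalues_eq_of_congr hHwh h₂ hgw hG'w]
  have hsgn : ∀ w : {w : InfinitePlace L // w.IsComplex},
      0 < (UnitaryGroup.evalC L w (Ya.map F).det).re ↔ 0 < (UnitaryGroup.evalC L w (Ha.map F * y₁).det).re := by
    intro w
    have e₁ : (Ya.map F).det = F k * F Ha.det := by
      rw [← RingHom.mapMatrix_apply, ← RingHom.map_det, hYa, map_mul]
    have e₂ : (Ha.map F * y₁).det = F k * F Ha.det * (σv (πv (z : 𝔸)) * πv (z : 𝔸)) := by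
      rw [Matrix.det_mul, hdet₁', ← RingHom.mapMatrix_apply, ← RingHom.map_det]; ring
    set u : ℂ := UnitaryGroup.evalC L w (πv (z : 𝔸)) with hu'
    have hσu : UnitaryGroup.evalC L w (σv (πv (z : 𝔸))) = starRingEnd ℂ u := UnitaryGroup.evalC_conjMixed _ L _ (hfix w.1) hc1 _
    have hu0 : u ≠ 0 := ((((Units.isUnit z).map πv).map (UnitaryGroup.evalC L w)).ne_zero :)
    have hnu : starRingEnd ℂ u * u = ((Complex.normSq u : ℝ) : ℂ) := by rw [Complex.normSq_eq_conj_mul_self]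
    have hpos : 0 < Complex.normSq u := Complex.normSq_pos.mpr hu0
    rw [e₁, e₂, map_mul (UnitaryGroup.evalC L w) (F k * F Ha.det), map_mul (UnitaryGroup.evalC L w) (σv (πv (z : 𝔸))), hσu, hnu,
      Complex.re_mul_ofReal]
    exact (mul_pos_iff_of_pos_right hpos).symm
  -- (6) ★ (h3′) in sign form: a `γ`-centralising congruence `ᵗ(σt) G t = G'`
  obtain ⟨t, htγ, htG⟩ := exists_commute_twistGram_arch_eq_of_signatures_of_det_sign_cm L hG hG' hGd hG'd hγv_frame hGP hG'P hsig hsgn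
  refine ⟨t, Units.ext ?_, ?_⟩
  · show t.val * (γ𝔸 : Matrix (Fin 3) (Fin 3) 𝔸).map πv = (γ𝔸 : Matrix (Fin 3) (Fin 3) 𝔸).map πv * t.val
    exact htγ
  · -- `x_∞ = Hv⁻¹ G' = Hv⁻¹ ᵗ(σt) (H y)_∞ t = t⋆ y_∞ t`
    rw [hxv_eq, ← htG, twistGram_def, hGdef, Matrix.map_mul, hermStar_def, Matrix.map_map, ← RingHom.coe_comp, ← hFdef, hHvF]
    simp only [← Matrix.mul_assoc]
    rfl

end Arch

end Literature.NumberTheory.Rogawski1990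

end
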